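import Mathlib.Geometry.Manifold.BumpFunction
import Summits.FinalStateConjecture.FinalStateConjecture.Theorems.ZeroEnergyKerrOrBombErgoregionBombModTNullFrequencyCompact
import Literature.Geometry.Riemannian.ConvexSublevelShortGeodesics
import Literature.Geometry.Lorentzian.MassCapacityHarmonic

/-!
# `ErgoregionBombModT` — U2: uniform certificate constants over a compact set
# (crux stmt-FinalStateConjecture-17838, line `SketchIdeator4` / zero-energy escape, stub U2 `stub_certificateCompactness`)

Route `ZeroEnergyKerrOrBomb` of the Final State Conjecture, crux `ErgoregionBombModT`, line
`SketchIdeator4` (zero-energy escape), v3 kernel reshaping `KERNEL ⇐ X ∧ U1 ∧ U2 ∧ ZF₀`.  This file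
proves **U2**: over a compact set `S`, *pointwise* strict convexity `Hess F_x(k, k) > 0` on the
zero-energy null vectors `k ≠ 0` (`g(k, k) = 0`, `g(k, T) = 0`) together with spacelike level sets
of `τ` (`dτ_x(k) ≠ 0` for null `k ≠ 0` over an open `W ⊇ S`) give *uniform* constants `c > 0`, `C`
with `c · dτ(k)² ≤ Hess F(k, k)` and `|Hess τ(k, k)| ≤ C · dτ(k)²` for every zero-energy null `k`
over `S`; here `F, τ` are only `C²` on `W`.

* `exists_contMDiff_eventuallyEq_of_contMDiffOn` — a function `C^m` (`m ≤ ∞`) on an open set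
  agrees near any of its points with a globally `C^m` function (multiply by a smooth bump function
  supported in the open set, Mathlib's `SmoothBumpFunction`).
* `continuousOn_hessian_tangentBundle` — for `F` of class `C²` on an open `W`, the Hessian
  quadratic form `p ↦ Hess F_{π p}(p, p)` is continuous on `π ⁻¹' W ⊆ TM` (locality of the
  Hessian, `PseudoRiemannianMetric.hessian_congr_of_eventuallyEq`, and the tree's global statement
  `Literature.Geometry.Riemannian.continuous_hessian_tangentBundle`).
* `continuous_val_apply_section_tangentBundle` — for a `C^n` vector field `T`, `p ↦ g(p, T(π p))`
  is continuous on `TM` (pattern of `PseudoRiemannianMetric.continuous_val_tangentBundle`).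
* `exists_certificate_constants` — the general statement, for a `C^n` metric (`1 ≤ n`) with
  Levi-Civita connection on a locally compact Hausdorff manifold with finite-dimensional complete
  model.  Proof: the set `Q = {p ∈ TM | π p ∈ S, g(p, p) = 0, g(p, T) = 0, dτ(p) = 1}` is closed
  and contained in the compact set of `exists_isCompact_null_frequency_superset` (G5, p155062),
  hence compact; the two Hessian quadratic forms are continuous on `π ⁻¹' W ⊇ Q`, and `Hess F > 0`
  on `Q` (`dτ(p) = 1` forces `p ≠ 0`), so `c := min_Q Hess F > 0` (or `1` if `Q = ∅`) and
  `C := sup_Q |Hess τ|` work: for a zero-energy null `k` over `S`, either `k = 0` (both sides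
  vanish) or `λ := dτ(k) ≠ 0` and `λ⁻¹ k ∈ Q`, and both sides are `2`-homogeneous in `k`.
* `stub_certificateCompactness` — the registered stub U2: the specialisation to the spacetime of a
  stationary asymptotically flat black hole `𝓑` (`T` the stationary Killing field, smooth; the
  carrier, a `4`-manifold, is locally compact by `Manifold.locallyCompact_of_finiteDimensional`).

References: B. O'Neill, *Semi-Riemannian geometry*, Academic Press 1983, Ch. 3,
Def. 3.48–Lemma 3.49 (the Hessian tensor); J. M. Lee, *Introduction to Riemannian Manifolds*,
2nd ed. (2018), Lemma 6.19 (compactness over a compact set); crux workfiles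
`Cruxes/ErgoregionBombModT/Ideas/zero-energy-escape.md`, `Lines/SketchIdeator4.lean`.
-/

noncomputable section

open Bundle Set Filter
open Literature.Geometry.Lorentzian
open scoped Manifold ContDiff Topology

-- summit = problem name (D-0017)
set_option linter.dupNamespace false

namespace Summit.FinalStateConjecture.FinalStateConjecture.Theorems.ErgoregionBombModT

variable {E : Type*} [NormedAddCommGroup E] [NormedSpace ℝ E] {H : Type*} [TopologicalSpace H]
  {I : ModelWithCorners ℝ E H} {M : Type*} [TopologicalSpace M] [ChartedSpace H M]
  [IsManifold I ∞ M] {n : ℕ∞ω}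

/-- **Local `C^m` extension.**  If `F` is `C^m` (`m ≤ ∞`) on an open set `W` of a Hausdorff
manifold with finite-dimensional model and `x₀ ∈ W`, there is a globally `C^m` function agreeing
with `F` near `x₀`: `f • F` for a smooth bump function `f` at `x₀` with `tsupport f ⊆ W`
(`SmoothBumpFunction.nhds_basis_tsupport`; smooth on `tsupport ⊆ W` as a product, hence
everywhere, `contMDiff_of_tsupport`; and `f = 1` near `x₀`). [folklore] -/
private theorem exists_contMDiff_eventuallyEq_of_contMDiffOn [FiniteDimensional ℝ E] [T2Space M]
    {m : ℕ∞ω} (hm : m ≤ ∞) {F : M → ℝ} {W : Set M} (hW : IsOpen W)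
    (hF : ContMDiffOn I 𝓘(ℝ, ℝ) m F W) {x₀ : M} (hx₀ : x₀ ∈ W) :
    ∃ F' : M → ℝ, ContMDiff I 𝓘(ℝ, ℝ) m F' ∧ F' =ᶠ[𝓝 x₀] F := by
  obtain ⟨f, -, hf⟩ :=
    (SmoothBumpFunction.nhds_basis_tsupport (I := I) x₀).mem_iff.1 (hW.mem_nhds hx₀)
  refine ⟨fun x ↦ f x • F x, ?_, ?_⟩
  · refine contMDiff_of_tsupport fun x hx ↦ ?_
    have hxW : x ∈ W := hf (tsupport_smul_subset_left _ _ hx)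
    exact ((f.contMDiff.of_le hm).contMDiffAt).smul (hF.contMDiffAt (hW.mem_nhds hxW))
  · filter_upwards [f.eventuallyEq_one] with x hx
    rw [hx, Pi.one_apply, one_smul]

/-- **Continuity of the Hessian quadratic form over an open set.**  For a `C^n` metric `g`
(`1 ≤ n`) with Levi-Civita connection and `F` of class `C²` on an open set `W`, the function
`p ↦ Hess F_{π p}(p, p)` is continuous on `π ⁻¹' W ⊆ TM`: near a point over `x₀ ∈ W`, `F` agrees
with a globally `C²` function `F'` (`exists_contMDiff_eventuallyEq_of_contMDiffOn`), the Hessian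
is local (`hessian_congr_of_eventuallyEq`, so `Hess F = Hess F'` over a neighbourhood of `x₀`),
and `p ↦ Hess F'_{π p}(p, p)` is continuous on `TM` (`continuous_hessian_tangentBundle`, O'Neill
1983, Ch. 3, Def. 3.48–Lemma 3.49 in a local frame). [cite: ONeill1983, Ch. 3, Def. 3.48–Lemma 3.49] -/
theorem continuousOn_hessian_tangentBundle [FiniteDimensional ℝ E] [CompleteSpace E] [T2Space M]
    (g : PseudoRiemannianMetric I n E (TangentSpace I : M → Type _)) [Fact (1 ≤ n)]
    [g.HasLeviCivita] {F : M → ℝ} {W : Set M} (hW : IsOpen W)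
    (hF : ContMDiffOn I 𝓘(ℝ, ℝ) 2 F W) :
    ContinuousOn (fun p : TangentBundle I M ↦ g.hessian F p.proj p.2 p.2)
      (TotalSpace.proj ⁻¹' W) := by
  intro p₀ hp₀
  have h2 : (2 : ℕ∞ω) ≤ ∞ := by
    rw [show (2 : ℕ∞ω) = ((2 : ℕ∞) : ℕ∞ω) from rfl]
    exact WithTop.coe_le_coe.2 le_top
  obtain ⟨F', hF', heq⟩ := exists_contMDiff_eventuallyEq_of_contMDiffOn h2 hW hF hp₀
  have hc := Literature.Geometry.Riemannian.continuous_hessian_tangentBundle g hF'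
  refine (hc.continuousAt.congr ?_).continuousWithinAt
  have h1 : ∀ᶠ x in 𝓝 p₀.proj, F' =ᶠ[𝓝 x] F := heq.eventuallyEq_nhds
  have h3 : ∀ᶠ p in 𝓝 p₀, F' =ᶠ[𝓝 (TotalSpace.proj p)] F :=
    (FiberBundle.continuous_proj E (TangentSpace I)).continuousAt.tendsto.eventually h1
  filter_upwards [h3] with p hp
  rw [g.hessian_congr_of_eventuallyEq hp]

/-- **Continuity of `p ↦ g(p, T)` on the tangent bundle** for a `C^n` vector field `T`: the
metric is a `C^n` section of the bundle of bilinear forms; evaluate it over the projection on the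
identity section of `TM` and on `T ∘ π` (Mathlib's `ContMDiff.clm_bundle_apply₂`) and read off the
fibre component in the trivial line bundle (pattern of `continuous_val_tangentBundle`). [folklore] -/
theorem continuous_val_apply_section_tangentBundle
    (g : PseudoRiemannianMetric I n E (TangentSpace I : M → Type _))
    {T : Π x : M, TangentSpace I x}
    (hT : ContMDiff I (I.prod 𝓘(ℝ, E)) n
      (fun x ↦ (TotalSpace.mk' E x (T x) : TangentBundle I M))) :
    Continuous fun p : TangentBundle I M ↦ g.val p.proj p.2 (T p.proj) := by
  have hψ : ContMDiff I.tangent (I.prod 𝓘(ℝ, E →L[ℝ] E →L[ℝ] ℝ)) n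
      (fun p : TangentBundle I M ↦ TotalSpace.mk' (E →L[ℝ] E →L[ℝ] ℝ)
        (E := fun x : M ↦ TangentSpace I x →L[ℝ] TangentSpace I x →L[ℝ] ℝ)
        p.proj (g.val p.proj)) :=
    g.contMDiff.comp (Bundle.contMDiff_proj (TangentSpace I : M → Type _))
  have hv : ContMDiff I.tangent I.tangent n
      (fun p : TangentBundle I M ↦ (TotalSpace.mk' E p.proj p.2 : TangentBundle I M)) :=
    contMDiff_id
  have hT' : ContMDiff I.tangent I.tangent n
      (fun p : TangentBundle I M ↦ (TotalSpace.mk' E p.proj (T p.proj) : TangentBundle I M)) :=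
    hT.comp (Bundle.contMDiff_proj (TangentSpace I : M → Type _))
  have h2 : ContMDiff I.tangent (I.prod 𝓘(ℝ, ℝ)) n
      (fun p : TangentBundle I M ↦
        TotalSpace.mk' ℝ (E := Bundle.Trivial M ℝ) p.proj (g.val p.proj p.2 (T p.proj))) :=
    hψ.clm_bundle_apply₂ (F₁ := E) (F₂ := E) hv hT'
  exact ((Bundle.Trivial.homeomorphProd M ℝ).continuous.comp h2.continuous).snd

/-- **Uniform certificate constants over a compact set.**  Let `g` be a `C^n` metric (`1 ≤ n`)
with Levi-Civita connection on a locally compact Hausdorff manifold with finite-dimensional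
complete model, `T` a `C^n` vector field, `S` compact, `W ⊇ S` open, `F, τ` of class `C²` on `W`
with `dτ_x(k) ≠ 0` for `x ∈ W` and null `k ≠ 0`, and `Hess F_x(k, k) > 0` for `x ∈ S` and
zero-energy null `k ≠ 0` (`g(k, k) = 0`, `g(k, T) = 0`).  Then there are `c > 0` and `C` with
`c · dτ(k)² ≤ Hess F(k, k)` and `|Hess τ(k, k)| ≤ C · dτ(k)²` for every zero-energy null `k` over
`S`.  Proof: `Q = {p | π p ∈ S, g(p, p) = 0, g(p, T) = 0, dτ(p) = 1}` is closed and lies in the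
compact set of `exists_isCompact_null_frequency_superset`, hence is compact; the Hessian quadratic
forms are continuous on `π ⁻¹' W ⊇ Q` and `Hess F > 0` on `Q`, so `c := min_Q Hess F` (or `1`),
`C := sup_Q |Hess τ|`; for `k ≠ 0`, `λ := dτ(k) ≠ 0`, `λ⁻¹ k ∈ Q`, and both sides are
`2`-homogeneous. [folklore] -/
theorem exists_certificate_constants [LocallyCompactSpace M] [FiniteDimensional ℝ E]
    [CompleteSpace E] [T2Space M]
    (g : PseudoRiemannianMetric I n E (TangentSpace I : M → Type _)) [Fact (1 ≤ n)]
    [g.HasLeviCivita] {T : Π x : M, TangentSpace I x}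
    (hT : ContMDiff I (I.prod 𝓘(ℝ, E)) n
      (fun x ↦ (TotalSpace.mk' E x (T x) : TangentBundle I M)))
    {S W : Set M} {F τ : M → ℝ} (hS : IsCompact S) (hW : IsOpen W) (hSW : S ⊆ W)
    (hF : ContMDiffOn I 𝓘(ℝ, ℝ) 2 F W) (hτ : ContMDiffOn I 𝓘(ℝ, ℝ) 2 τ W)
    (hnd : ∀ x ∈ W, ∀ k : TangentSpace I x, g.val x k k = 0 → k ≠ 0 → mvfderiv I τ x k ≠ 0)
    (hpos : ∀ x ∈ S, ∀ k : TangentSpace I x, g.val x k k = 0 → g.val x k (T x) = 0 → k ≠ 0 →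
      0 < g.hessian F x k k) :
    ∃ c C : ℝ, 0 < c ∧ ∀ x ∈ S, ∀ k : TangentSpace I x, g.val x k k = 0 → g.val x k (T x) = 0 →
      c * (mvfderiv I τ x k) ^ 2 ≤ g.hessian F x k k ∧
        |g.hessian τ x k k| ≤ C * (mvfderiv I τ x k) ^ 2 := by
  -- the ingredients: continuity on `TM` / on `π ⁻¹' W`, and the compact superset of G5
  have hτ1 : ContMDiffOn I 𝓘(ℝ, ℝ) 1 τ W := hτ.of_le one_le_two
  have hgc := g.continuous_val_tangentBundle
  have hTc := continuous_val_apply_section_tangentBundle g hT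
  have hdτ := continuousOn_mvfderiv_tangentBundle (I := I) hW hτ1
  have hHF := continuousOn_hessian_tangentBundle g hW hF
  have hHτ := continuousOn_hessian_tangentBundle g hW hτ
  obtain ⟨𝒦, h𝒦, h𝒦mem⟩ := exists_isCompact_null_frequency_superset g 1 hS hW hSW hτ1 hnd
  -- the set `Q` of zero-energy null vectors of unit frequency over `S`
  set Q : Set (TangentBundle I M) :=
    (TotalSpace.proj ⁻¹' S ∩ (fun p : TangentBundle I M ↦ mvfderiv I τ p.proj p.2) ⁻¹' {1}) ∩
      {p | g.val p.proj p.2 p.2 = 0} ∩ {p | g.val p.proj p.2 (T p.proj) = 0}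
  have hQW : Q ⊆ TotalSpace.proj ⁻¹' W := fun p hp ↦ hSW hp.1.1.1
  have hQc : IsCompact Q := by
    refine h𝒦.of_isClosed_subset ?_ fun p hp ↦ h𝒦mem p hp.1.1.1 hp.1.2 ?_
    · have hSc : IsClosed (TotalSpace.proj ⁻¹' S : Set (TangentBundle I M)) :=
        hS.isClosed.preimage (FiberBundle.continuous_proj E (TangentSpace I))
      refine (((hdτ.mono (preimage_mono hSW)).preimage_isClosed_of_isClosed hSc
        isClosed_singleton).inter (isClosed_eq hgc continuous_const)).inter
          (isClosed_eq hTc continuous_const)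
    · have h1 : mvfderiv I τ p.proj p.2 = 1 := hp.1.1.2
      rw [h1, abs_one]
  -- the constant `c`
  obtain ⟨c, hc, hcle⟩ : ∃ c : ℝ, 0 < c ∧ ∀ p ∈ Q, c ≤ g.hessian F p.proj p.2 p.2 := by
    by_cases hne : Q.Nonempty
    · obtain ⟨p₀, hp₀, hmin⟩ := hQc.exists_isMinOn hne (hHF.mono hQW)
      refine ⟨g.hessian F p₀.proj p₀.2 p₀.2, ?_, fun p hp ↦ hmin hp⟩
      have h1 : mvfderiv I τ p₀.proj p₀.2 = 1 := hp₀.1.1.2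
      refine hpos _ hp₀.1.1.1 _ hp₀.1.2 hp₀.2 fun h0 ↦ ?_
      rw [h0, map_zero] at h1
      exact zero_ne_one h1
    · exact ⟨1, one_pos, fun p hp ↦ (hne ⟨p, hp⟩).elim⟩
  -- the constant `C`
  obtain ⟨C, hC⟩ := hQc.exists_bound_of_continuousOn (hHτ.mono hQW)
  refine ⟨c, C, hc, fun x hx k hk0 hkT ↦ ?_⟩
  by_cases hk : k = 0
  · subst hk
    simp
  -- `k ≠ 0`: normalise the frequency
  set l : ℝ := mvfderiv I τ x k with hl_def
  have hl : l ≠ 0 := hnd x (hSW hx) k hk0 hk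
  have hl2 : 0 < l ^ 2 := by positivity
  have hpQ : (TotalSpace.mk' E x (l⁻¹ • k) : TangentBundle I M) ∈ Q := by
    refine ⟨⟨⟨hx, ?_⟩, ?_⟩, ?_⟩
    · show mvfderiv I τ x (l⁻¹ • k) ∈ ({1} : Set ℝ)
      rw [mem_singleton_iff, map_smul, smul_eq_mul, ← hl_def, inv_mul_cancel₀ hl]
    · show g.val x (l⁻¹ • k) (l⁻¹ • k) = 0
      simp [hk0]
    · show g.val x (l⁻¹ • k) (T x) = 0
      simp [hkT]
  have hF1 : c ≤ g.hessian F x (l⁻¹ • k) (l⁻¹ • k) :=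
    hcle (TotalSpace.mk' E x (l⁻¹ • k)) hpQ
  have hτ1' : ‖g.hessian τ x (l⁻¹ • k) (l⁻¹ • k)‖ ≤ C := hC (TotalSpace.mk' E x (l⁻¹ • k)) hpQ
  have hFs : g.hessian F x (l⁻¹ • k) (l⁻¹ • k) = l⁻¹ * (l⁻¹ * g.hessian F x k k) := by
    simp only [map_smul, LinearMap.smul_apply, smul_eq_mul]
  have hτs : g.hessian τ x (l⁻¹ • k) (l⁻¹ • k) = l⁻¹ * (l⁻¹ * g.hessian τ x k k) := by
    simp only [map_smul, LinearMap.smul_apply, smul_eq_mul]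
  have hll : l⁻¹ * l⁻¹ * l ^ 2 = 1 := by
    rw [← mul_inv, ← sq, inv_mul_cancel₀ hl2.ne']
  refine ⟨?_, ?_⟩
  · rw [hFs, ← mul_assoc] at hF1
    calc c * l ^ 2 ≤ l⁻¹ * l⁻¹ * g.hessian F x k k * l ^ 2 :=
          mul_le_mul_of_nonneg_right hF1 hl2.le
      _ = g.hessian F x k k := by
          rw [mul_comm (l⁻¹ * l⁻¹), mul_assoc, hll, mul_one]
  · rw [hτs, ← mul_assoc, Real.norm_eq_abs, abs_mul, abs_of_nonneg (mul_self_nonneg l⁻¹)]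
      at hτ1'
    calc |g.hessian τ x k k| = l⁻¹ * l⁻¹ * |g.hessian τ x k k| * l ^ 2 := by
          rw [mul_comm (l⁻¹ * l⁻¹), mul_assoc, hll, mul_one]
      _ ≤ C * l ^ 2 := mul_le_mul_of_nonneg_right hτ1' hl2.le

/-- **U2 (uniform certificate constants over a compact set).**  On the spacetime of a stationary
asymptotically flat black hole `𝓑` with stationary Killing field `T = 𝓑.killing`: if `S` is
compact, `W ⊇ S` open, `F, τ` are `C²` on `W`, the level sets of `τ` are spacelike over `W`
(`dτ_x(k) ≠ 0` for null `k ≠ 0`), and `Hess F_x(k, k) > 0` for every `x ∈ S` and every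
zero-energy null `k ≠ 0` (`g(k, k) = 0`, `g(k, T) = 0`), then there are constants `c > 0`, `C`
with `c · dτ(k)² ≤ Hess F(k, k)` and `|Hess τ(k, k)| ≤ C · dτ(k)²` for all zero-energy null `k`
over `S`.  This is `exists_certificate_constants` for the metric of `𝓑` (the Killing field is
smooth; the carrier, a `4`-manifold, is locally compact,
`Manifold.locallyCompact_of_finiteDimensional`). -/
theorem stub_certificateCompactness : ∀ (𝓑 : Literature.Geometry.Lorentzian.StationaryAFBlackHole.{0}) [𝓑.metric.HasLeviCivita] (S W : Set 𝓑.carrier) (F τ : 𝓑.carrier → ℝ), IsCompact S → IsOpen W → S ⊆ W → ContMDiffOn (𝓡 4) 𝓘(ℝ, ℝ) 2 F W → ContMDiffOn (𝓡 4) 𝓘(ℝ, ℝ) 2 τ W → (∀ x ∈ W, ∀ k : TangentSpace (𝓡 4) x, 𝓑.metric.val x k k = 0 → k ≠ 0 → mvfderiv (𝓡 4) τ x k ≠ 0) → (∀ x ∈ S, ∀ k : TangentSpace (𝓡 4) x, 𝓑.metric.val x k k = 0 → 𝓑.metric.val x k (𝓑.killing x) = 0 → k ≠ 0 → 0 < 𝓑.metric.toPseudoRiemannianMetric.hessian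 F x k k) → ∃ c C : ℝ, 0 < c ∧ ∀ x ∈ S, ∀ k : TangentSpace (𝓡 4) x, 𝓑.metric.val x k k = 0 → 𝓑.metric.val x k (𝓑.killing x) = 0 → c * (mvfderiv (𝓡 4) τ x k) ^ 2 ≤ 𝓑.metric.toPseudoRiemannianMetric.hessian F x k k ∧ |𝓑.metric.toPseudoRiemannianMetric.hessian τ x k k| ≤ C * (mvfderiv (𝓡 4) τ x k) ^ 2 := by
  intro 𝓑 _ S W F τ hS hW hSW hF hτ hnd hpos
  haveI : LocallyCompactSpace 𝓑.carrier :=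
    Manifold.locallyCompact_of_finiteDimensional (M := 𝓑.carrier) (𝓡 4)
  exact exists_certificate_constants 𝓑.metric.toPseudoRiemannianMetric
    𝓑.isStationaryKilling.isKillingField.contMDiff hS hW hSW hF hτ hnd hpos

end Summit.FinalStateConjecture.FinalStateConjecture.Theorems.ErgoregionBombModT

end
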